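import Literature.Computability.AlgebraicComplexity.FlipGraph222StdComponentCanon3
import Literature.Computability.AlgebraicComplexity.FlipGraphLadermanIsolatedKM
import HarnessLib

/-!
# KM's flip-isolated rank-`8` scheme lies outside the standard algorithm's component (`(2,2,2)`, `ℤ₂`; KM 2023 §4)

Topic `Literature/Computability/AlgebraicComplexity`. Source: M. Kauers, J. Moosbauer, *Flip Graphs
for Matrix Multiplication*, ISSAC 2023 = arXiv:2212.01175 (KM), §4, on `K = ℤ₂` and the
`(2,2,2)`-flip graph of rank at most `8`: "we only found exactly one solution (up to symmetries) that
does not belong to this component: [the displayed eight-term scheme]. This scheme has no neighbors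
and thus forms a connected component of its own. We do not know whether the `(2,2,2)`-flip graph of
rank at most `8` has any further components."

## What is typed (everything PROVED; no named facts)

The tree already has the displayed scheme in coordinates (`FlipGraph222IsolatedKM.lean`:
`KM222Isolated.w/u/v`, Brent identity, no two terms share a factor, irreducible) and its isolation on
KM's orbit vertex set (`FlipGraphLadermanIsolatedKM.lean` §4: `KM222Isolated.scheme`,
`KM222Isolated.not_flipGraphKM`, `KM222Isolated.rank_lt_of_flipGraphKM`,
`kauersMoosbauer2023_222_isolated`). NEW here:

* **"does not belong to this component"** — `kauersMoosbauer2023_isolated_not_mem_std_component :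
  vtxIso ∉ (flipGraph222LE8.connectedComponentMk vtxStd).supp`: the orbit of the displayed scheme is
  none of the `273` vertices of the standard algorithm's component
  (`Comp222.kauersMoosbauer2023_fig1_component_supp`), because its canonical orbit key
  (`Canon222.canonKey`, `FlipGraph222OrbitCanon.lean`) reduced mod `keyMod` is none of the `273`
  tabulated keys `canonTab` (`key_notin`, kernel evaluation; `Comp222.canonKey_creps`); the bridge
  `elts3_isoL_eq` identifies the code list `isoL` used for the key with the printed family
  `fam KM222Isolated.w KM222Isolated.u KM222Isolated.v`;
* the same isolation in the vocabulary of the undirected graph `flipGraph222LE8` of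
  `FlipGraphStdStrassenDistance.lean` (flips and reductions either way, orbits of rank `≤ 8`), as used
  by the component files: `kauersMoosbauer2023_isolated_neighborSet : flipGraph222LE8.neighborSet vtxIso = ∅`
  and `kauersMoosbauer2023_isolated_component : (flipGraph222LE8.connectedComponentMk vtxIso).supp = {vtxIso}`
  (corollaries of `KM222Isolated.not_flipGraphKM` / `rank_lt_of_flipGraphKM`);
* hence `two_components`: the rank-`≤ 8` graph has at least the two components of `vtxStd` (`273`
  vertices, `Comp222.kauersMoosbauer2023_fig1_component_card`) and of `vtxIso` (`1` vertex).

HONEST FRAMING: statements about `⟨2,2,2⟩` over `ℤ₂` and KM's group `G`; KM's "exactly one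
solution [found by SAT]" and their open question about further components are NOT typed (this
cell's complete classification of the rank-`8` schemes — `274` orbits, exactly these two components —
is a certificate outside the kernel).

## References

* M. Kauers, J. Moosbauer, *Flip Graphs for Matrix Multiplication*, ISSAC 2023, 381–388,
  doi:10.1145/3597066.3597120, arXiv:2212.01175: §4 (the displayed isolated scheme and the two
  sentences quoted above), Def. 8, Thm. 9. [KauersMoosbauer2022FlipGraphs]
-/

set_option Elab.async false

namespace Literature.Computability.AlgebraicComplexity

open scoped BigOperators Kronecker
open Multiset Matrix

namespace FlipGraph

namespace Iso222

open Cert222 StdBall222 Hidden222 Canon222 Comp222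

/-! ## §1 The printed scheme as a code list; the key check -/

/-- KM's displayed isolated scheme as code triples `(z, x, y)` (output factor first; bit `2 i + j` =
entry `(i, j)`), in printed order — the codes of `KM222Isolated.w/u/v`. [cite: KauersMoosbauer2022FlipGraphs, §4 ("This scheme has no neighbors and thus forms a connected component of its own")] -/
def isoL : List Tri := [(2,9,9), (14,8,5), (12,12,1), (1,1,10), (11,2,15), (8,6,3), (10,10,12), (3,3,11)]

/-- The code list is well formed (non-zero codes `< 16`). [cite: KauersMoosbauer2022FlipGraphs, §4 ("This scheme has no neighbors and thus forms a connected component of its own")] -/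
theorem wfL_isoL : wfL isoL = true := by decide +kernel

/-- **Bridge to `FlipGraph222IsolatedKM.lean`:** the code list presents exactly the printed family of
eight rank-one tensors (kernel evaluation). [cite: KauersMoosbauer2022FlipGraphs, §4 ("This scheme has no neighbors and thus forms a connected component of its own")] -/
theorem elts3_isoL_eq : elts3 isoL = fam KM222Isolated.w KM222Isolated.u KM222Isolated.v := by
  decide +kernel

/-- Hence the elements of the tree's `KM222Isolated.scheme` are presented by `isoL`. [cite: KauersMoosbauer2022FlipGraphs, §4 ("This scheme has no neighbors and thus forms a connected component of its own")] -/
theorem scheme_elts_isoL : KM222Isolated.scheme.elts = elts3 isoL := by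
  rw [KM222Isolated.scheme_elts, elts3_isoL_eq]

/-- **The orbit key of the isolated scheme is none of the `273` keys of the standard algorithm's
component** (kernel evaluation of `canonKey isoL % keyMod` against `canonTab`). [cite: KauersMoosbauer2022FlipGraphs, §4 ("exactly one solution (up to symmetries) that does not belong to this component")] -/
theorem key_notin :
    ((List.range 273).all fun i => canonTab.getD i 0 != canonKey isoL % keyMod) = true := by
  decide +kernel

/-! ## §2 The vertex and its isolation in `flipGraph222LE8` -/

/-- **The vertex `vtxIso`** of KM's flip graph of rank at most `8`: the orbit of the displayed
scheme (rank `8`). [cite: KauersMoosbauer2022FlipGraphs, §4 ("This scheme has no neighbors and thus forms a connected component of its own")] -/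
noncomputable def vtxIso : Vtx222LE8 :=
  ⟨Quotient.mk _ KM222Isolated.scheme, by rw [orbitRankKM_mk, KM222Isolated.rank_scheme]⟩

/-- **No edge of KM's flip graph at the orbit, in either direction, within rank `≤ 8`** (from the
tree's `KM222Isolated.not_flipGraphKM` and `rank_lt_of_flipGraphKM`). [cite: KauersMoosbauer2022FlipGraphs, §4 ("This scheme has no neighbors and thus forms a connected component of its own")] -/
theorem no_edge {p' : Quotient (orbitSetoidKM (ZMod 2) 2)}
    (he : flipGraphKM (ZMod 2) 2 vtxIso.1 p' ∨ flipGraphKM (ZMod 2) 2 p' vtxIso.1)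
    (hr : orbitRankKM p' ≤ 8) : False := by
  rcases he with he | he
  · exact KM222Isolated.not_flipGraphKM p' he
  · obtain ⟨y, rfl, hy⟩ := KM222Isolated.rank_lt_of_flipGraphKM he
    rw [orbitRankKM_mk] at hr
    omega

/-- **KM §4: "This scheme has no neighbors"** — in the undirected graph `flipGraph222LE8` (flips and
reductions either way) on the orbits of rank `≤ 8`. [cite: KauersMoosbauer2022FlipGraphs, §4 ("This scheme has no neighbors and thus forms a connected component of its own")] -/
theorem kauersMoosbauer2023_isolated_neighborSet : flipGraph222LE8.neighborSet vtxIso = ∅ := by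
  ext v
  simp only [SimpleGraph.mem_neighborSet, Set.mem_empty_iff_false, iff_false]
  intro h
  rw [flipGraph222LE8, SimpleGraph.fromRel_adj] at h
  exact no_edge h.2 v.2

/-- **KM §4: "… and thus forms a connected component of its own"** — the connected component of
`vtxIso` in `flipGraph222LE8` is `{vtxIso}`. [cite: KauersMoosbauer2022FlipGraphs, §4 ("This scheme has no neighbors and thus forms a connected component of its own")] -/
theorem kauersMoosbauer2023_isolated_component :
    (flipGraph222LE8.connectedComponentMk vtxIso).supp = {vtxIso} := by
  ext v
  rw [SimpleGraph.ConnectedComponent.mem_supp_iff, SimpleGraph.ConnectedComponent.eq,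
    Set.mem_singleton_iff]
  constructor
  · intro h
    obtain ⟨p⟩ := h.symm
    suffices key : ∀ (u w : Vtx222LE8) (q : flipGraph222LE8.Walk u w), u = vtxIso → w = u from
      key _ _ p rfl
    intro u w q
    induction q with
    | nil => intro _; rfl
    | @cons a b c hadj _ _ =>
      intro ha
      subst ha
      rw [flipGraph222LE8, SimpleGraph.fromRel_adj] at hadj
      exact (no_edge hadj.2 b.2).elim
  · rintro rfl
    exact SimpleGraph.Reachable.refl _

/-! ## §3 Not in the standard algorithm's component -/

/-- From a `List.all` over `List.range` to each index (bookkeeping). [folklore] -/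
private theorem all_range_imp {f : ℕ → Bool} {n : ℕ} (h : ((List.range n).all f) = true)
    (i : ℕ) (hi : i < n) : f i = true := by
  rw [List.all_eq_true] at h
  exact h i (List.mem_range.mpr hi)

/-- **The isolated orbit is none of the `273` listed orbits** (different canonical key). [cite: KauersMoosbauer2022FlipGraphs, §4 ("exactly one solution (up to symmetries) that does not belong to this component")] -/
theorem vtxIso_ne_cv (i : Fin 273) : vtxIso ≠ cv i := by
  intro h
  have hq : Quotient.mk (orbitSetoidKM (ZMod 2) 2) KM222Isolated.scheme = Quotient.mk _ (cs i) :=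
    congrArg Subtype.val h
  refine not_equiv_of_canonKey_ne wfL_isoL (wfL_creps i) scheme_elts_isoL (cs_elts i) ?_
    (Quotient.exact hq)
  intro heq
  have hk := all_range_imp key_notin i.val i.isLt
  rw [← canonKey_creps i.val i.isLt, ← heq] at hk
  simp at hk

/-- **KM §4: the isolated scheme "does not belong to this component"** — kernel: its orbit is not a
vertex of the standard algorithm's (`273`-vertex) component. [cite: KauersMoosbauer2022FlipGraphs, §4 ("exactly one solution (up to symmetries) that does not belong to this component")] -/
theorem kauersMoosbauer2023_isolated_not_mem_std_component :
    vtxIso ∉ (flipGraph222LE8.connectedComponentMk vtxStd).supp := by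
  rw [kauersMoosbauer2023_fig1_component_supp]
  rintro ⟨i, hi⟩
  exact vtxIso_ne_cv i hi.symm

/-- Hence the rank-`≤ 8` flip graph of `⟨2,2,2⟩` over `ℤ₂` has **at least two components** (the
standard algorithm's, `273` vertices, and `{vtxIso}`); that these `274` orbits are ALL of it is this
cell's certificate, not a kernel theorem. [cite: KauersMoosbauer2022FlipGraphs, §4 ("exactly one solution (up to symmetries) that does not belong to this component")] -/
theorem two_components :
    flipGraph222LE8.connectedComponentMk vtxIso ≠ flipGraph222LE8.connectedComponentMk vtxStd := by
  intro h
  apply kauersMoosbauer2023_isolated_not_mem_std_component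
  rw [← h]
  exact rfl

end Iso222

end FlipGraph

end Literature.Computability.AlgebraicComplexity
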